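import Literature.Probability.LatticeModels.LatticeLaplacian
import Literature.Probability.LatticeModels.SRWStepSequences
import HarnessLib

/-!
# The Laplacian of the edge-killed simple random walk on a subgraph of `ℤ²`

Topic `Literature/Probability/LatticeModels`; discrete potential theory for the simple random
walk on `ℤ²` **run along the edges of a subgraph `Gr` and killed at its first step that is not a
`Gr`-edge** (the walk of `SRW.killedGreen`, `SRWKilledWalkFunctionals.lean`; for
`Gr = discreteDomainGraph Ω δ` this is the walk of the tree's scaling-limit statements). A
function `h : ℤ² → ℝ` is harmonic for this walk at `v` iff

  `h v = ¼ ∑_{e ∈ {±e₀, ±e₁}} [Gr.Adj v (v + e)] · h (v + e)`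

(`killedAvg`; the non-edges contribute the value `0` of the cemetery). This is the hypothesis
of the uniform boundary Harnack principle isolated in `MartinRatioBoundaryLimit.lean`
(`KozdronLawler2005_martinRatioBoundaryLimit_of_uniformBHP`). For the induced subgraph on a vertex
set `A` it is the usual harmonicity of the walk killed on leaving `A` (Lawler–Limic 2010, §6.1),
and where all four lattice edges at `v` are `Gr`-edges it is plain lattice harmonicity
(`killedAvg_eq_of_forall_adj`, `isKilledHarmonicOn_iff_isLatticeHarmonicOn`).

Contents (everything `[folklore]`, analytic — no random walks are used):
* `killedAvg Gr h v`, the sub-Markov neighbour average, and its linearity / monotonicity;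
* `IsKilledHarmonicOn`, `IsKilledSubharmonicOn`, `IsKilledSuperharmonicOn` on a set `S`, and the
  outer boundary `killedOuterBoundary Gr S` (sites outside `S` joined to `S` by a `Gr`-edge);
* the **maximum principle** `IsKilledSubharmonicOn.le_of_forall_boundary_le` (finite `S`,
  bound `M ≥ 0` on the outer boundary — the sign condition is forced by the killing), the
  comparison principle and uniqueness for the Dirichlet problem;
* **existence** for the Dirichlet problem on a finite set (`exists_isKilledHarmonicOn_eq_off`,
  linear algebra: the injective Dirichlet operator is surjective) and the solution operator
  `killedHarmExt Gr S g` with its bounds, linearity and monotonicity in the data;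
* the **Poisson kernel** `killedPoisson Gr S v x = killedHarmExt Gr S 1_{x} v` and the exit
  representation `h v = ∑_{x ∈ ∂S} killedPoisson Gr S v x · h x` of a killed-harmonic function on a
  finite set (`IsKilledHarmonicOn.eq_sum_killedPoisson`).

## References

* G. F. Lawler, V. Limic, *Random Walk: A Modern Introduction*, CUP (2010), §6.1–6.2 (Dirichlet
  problem, Poisson kernel `H_A(x,y)`, maximum principle for the walk killed on leaving `A`).
  [LawlerLimic2010]
* D. Chelkak, *Robust discrete complex analysis: a toolbox*, Ann. Probab. 44 (2016), §2.3
  (discrete harmonic measure as the solution of a Dirichlet problem). [Chelkak2016]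
-/

noncomputable section

open scoped Classical

namespace Literature.Probability.LatticeModels

open Finset

variable (Gr : SimpleGraph (Site 2))

/-! ### The four lattice directions -/

/-- The four steps `±e₀, ±e₁` of `ℤ²` indexed by `SRW.Dir 2 = Fin 2 × Bool` are the four
`cornerUnit` vectors: a sum over directions is the corresponding sum over `Fin 4`. [folklore] -/
theorem sum_dir_eq_sum_cornerUnit (f : Site 2 → ℝ) :
    ∑ e : SRW.Dir 2, f (SRW.stepVec e) = ∑ k : Fin 4, f (cornerUnit k) := by
  have h0 : SRW.stepVec ((0, true) : SRW.Dir 2) = cornerUnit 0 := by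
    simp [SRW.stepVec, cornerUnit]
  have h1 : SRW.stepVec ((1, true) : SRW.Dir 2) = cornerUnit 1 := by
    simp [SRW.stepVec, cornerUnit]
  have h2 : SRW.stepVec ((0, false) : SRW.Dir 2) = cornerUnit 2 := by
    simp [SRW.stepVec, cornerUnit]
  have h3 : SRW.stepVec ((1, false) : SRW.Dir 2) = cornerUnit 3 := by
    simp [SRW.stepVec, cornerUnit]
  rw [Fintype.sum_prod_type, Fin.sum_univ_two, Fintype.sum_bool, Fintype.sum_bool,
    Fin.sum_univ_four, h0, h1, h2, h3]
  ring

/-- A lattice neighbour `v + e` of `v` is adjacent to `v` in `ℤ²`. [folklore] -/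
theorem zdGraph_adj_add_stepVec (v : Site 2) (e : SRW.Dir 2) : (zdGraph 2).Adj v (v + SRW.stepVec e) :=
  SRW.adj_add_stepVec v e

/-! ### The sub-Markov neighbour average of the edge-killed walk -/

/-- The **neighbour average of the edge-killed walk**:
`killedAvg Gr h v = ¼ ∑_e [Gr.Adj v (v+e)] h (v+e)`, the sum over the four lattice directions;
directions whose edge is not a `Gr`-edge contribute `0` (the walk is killed). [folklore] -/
def killedAvg (h : Site 2 → ℝ) (v : Site 2) : ℝ :=
  4⁻¹ * ∑ e : SRW.Dir 2, if Gr.Adj v (v + SRW.stepVec e) then h (v + SRW.stepVec e) else 0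

/-- `killedAvg` unfolded. [folklore] -/
theorem killedAvg_def (h : Site 2 → ℝ) (v : Site 2) : killedAvg Gr h v =
    4⁻¹ * ∑ e : SRW.Dir 2, if Gr.Adj v (v + SRW.stepVec e) then h (v + SRW.stepVec e) else 0 := rfl

/-- The neighbour average is additive. [folklore] -/
theorem killedAvg_add (h₁ h₂ : Site 2 → ℝ) (v : Site 2) :
    killedAvg Gr (h₁ + h₂) v = killedAvg Gr h₁ v + killedAvg Gr h₂ v := by
  simp only [killedAvg, Pi.add_apply, ← mul_add, ← Finset.sum_add_distrib]
  congr 1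
  refine Finset.sum_congr rfl fun e _ => ?_
  split_ifs <;> simp

/-- The neighbour average is homogeneous. [folklore] -/
theorem killedAvg_const_mul (c : ℝ) (h : Site 2 → ℝ) (v : Site 2) :
    killedAvg Gr (fun x => c * h x) v = c * killedAvg Gr h v := by
  simp only [killedAvg, Finset.mul_sum]
  refine Finset.sum_congr rfl fun e _ => ?_
  split_ifs <;> ring

/-- The neighbour average of `-h`. [folklore] -/
theorem killedAvg_neg (h : Site 2 → ℝ) (v : Site 2) :
    killedAvg Gr (-h) v = -killedAvg Gr h v := by
  have := killedAvg_const_mul Gr (-1) h v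
  simp only [neg_mul, one_mul] at this
  rw [← this]
  rfl

/-- The neighbour average of a difference. [folklore] -/
theorem killedAvg_sub (h₁ h₂ : Site 2 → ℝ) (v : Site 2) :
    killedAvg Gr (h₁ - h₂) v = killedAvg Gr h₁ v - killedAvg Gr h₂ v := by
  rw [sub_eq_add_neg, killedAvg_add, killedAvg_neg, ← sub_eq_add_neg]

/-- The neighbour average of `0` is `0`. [folklore] -/
@[simp] theorem killedAvg_zero (v : Site 2) : killedAvg Gr (fun _ => (0 : ℝ)) v = 0 := by
  simp [killedAvg]

/-- The neighbour average only sees the values at the `Gr`-neighbours among the four lattice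
neighbours. [folklore] -/
theorem killedAvg_congr {h₁ h₂ : Site 2 → ℝ} {v : Site 2}
    (H : ∀ e : SRW.Dir 2, Gr.Adj v (v + SRW.stepVec e) → h₁ (v + SRW.stepVec e) = h₂ (v + SRW.stepVec e)) :
    killedAvg Gr h₁ v = killedAvg Gr h₂ v := by
  simp only [killedAvg]
  congr 1
  refine Finset.sum_congr rfl fun e _ => ?_
  split_ifs with he
  · exact H e he
  · rfl

/-- The neighbour average is monotone. [folklore] -/
theorem killedAvg_mono {h₁ h₂ : Site 2 → ℝ} {v : Site 2}
    (H : ∀ e : SRW.Dir 2, Gr.Adj v (v + SRW.stepVec e) → h₁ (v + SRW.stepVec e) ≤ h₂ (v + SRW.stepVec e)) :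
    killedAvg Gr h₁ v ≤ killedAvg Gr h₂ v := by
  simp only [killedAvg]
  refine mul_le_mul_of_nonneg_left (Finset.sum_le_sum fun e _ => ?_) (by norm_num)
  split_ifs with he
  · exact H e he
  · exact le_rfl

/-- The neighbour average of a nonnegative function is nonnegative. [folklore] -/
theorem killedAvg_nonneg {h : Site 2 → ℝ} {v : Site 2}
    (H : ∀ e : SRW.Dir 2, Gr.Adj v (v + SRW.stepVec e) → 0 ≤ h (v + SRW.stepVec e)) :
    0 ≤ killedAvg Gr h v := by
  have := killedAvg_mono Gr (h₁ := fun _ => (0 : ℝ)) (h₂ := h) (v := v) H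
  simpa using this

/-- **The average is at most the maximum** (sub-Markov property): if `h ≤ M` at the
`Gr`-neighbours of `v` and `0 ≤ M`, then `killedAvg Gr h v ≤ M`. [folklore] -/
theorem killedAvg_le_of_le {h : Site 2 → ℝ} {v : Site 2} {M : ℝ} (hM : 0 ≤ M)
    (H : ∀ e : SRW.Dir 2, Gr.Adj v (v + SRW.stepVec e) → h (v + SRW.stepVec e) ≤ M) :
    killedAvg Gr h v ≤ M := by
  simp only [killedAvg]
  have hle : ∀ e ∈ (univ : Finset (SRW.Dir 2)),
      (if Gr.Adj v (v + SRW.stepVec e) then h (v + SRW.stepVec e) else 0) ≤ M := fun e _ => by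
    split_ifs with he
    · exact H e he
    · exact hM
  have hsum := Finset.sum_le_sum hle
  simp only [Finset.sum_const, Finset.card_univ, SRW.card_dir, nsmul_eq_mul] at hsum
  push_cast at hsum
  linarith

/-- Where all four lattice edges at `v` are `Gr`-edges, the killed average is the plain lattice
average `¼ ∑_k h (v + e_k)`. [folklore] -/
theorem killedAvg_eq_of_forall_adj {h : Site 2 → ℝ} {v : Site 2}
    (H : ∀ e : SRW.Dir 2, Gr.Adj v (v + SRW.stepVec e)) :
    killedAvg Gr h v = 4⁻¹ * ∑ k : Fin 4, h (v + cornerUnit k) := by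
  simp only [killedAvg, H, if_true]
  rw [sum_dir_eq_sum_cornerUnit (fun w => h (v + w))]


/-! ### Harmonic, subharmonic and superharmonic functions of the killed walk -/

/-- `h` is **harmonic for the edge-killed walk** on `S`: `h v = killedAvg Gr h v` at every site
of `S` (Lawler–Limic 2010, §6.1, for the walk killed on leaving a set; here with edge killing).
[cite: LawlerLimic2010, §6.1] -/
def IsKilledHarmonicOn (h : Site 2 → ℝ) (S : Set (Site 2)) : Prop :=
  ∀ v ∈ S, h v = killedAvg Gr h v

/-- `h` is **subharmonic** for the edge-killed walk on `S`: `h v ≤ killedAvg Gr h v` on `S`. [folklore] -/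
def IsKilledSubharmonicOn (h : Site 2 → ℝ) (S : Set (Site 2)) : Prop :=
  ∀ v ∈ S, h v ≤ killedAvg Gr h v

/-- `h` is **superharmonic** for the edge-killed walk on `S`: `killedAvg Gr h v ≤ h v` on `S`. [folklore] -/
def IsKilledSuperharmonicOn (h : Site 2 → ℝ) (S : Set (Site 2)) : Prop :=
  ∀ v ∈ S, killedAvg Gr h v ≤ h v

variable {Gr}

/-- Harmonic functions are subharmonic. [folklore] -/
theorem IsKilledHarmonicOn.subharmonicOn {h : Site 2 → ℝ} {S : Set (Site 2)}
    (H : IsKilledHarmonicOn Gr h S) : IsKilledSubharmonicOn Gr h S := fun v hv => (H v hv).le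

/-- Harmonic functions are superharmonic. [folklore] -/
theorem IsKilledHarmonicOn.superharmonicOn {h : Site 2 → ℝ} {S : Set (Site 2)}
    (H : IsKilledHarmonicOn Gr h S) : IsKilledSuperharmonicOn Gr h S := fun v hv => (H v hv).ge

/-- Restriction to a subset. [folklore] -/
theorem IsKilledHarmonicOn.mono {h : Site 2 → ℝ} {S T : Set (Site 2)}
    (H : IsKilledHarmonicOn Gr h S) (hTS : T ⊆ S) : IsKilledHarmonicOn Gr h T :=
  fun v hv => H v (hTS hv)

/-- Restriction to a subset. [folklore] -/
theorem IsKilledSubharmonicOn.mono {h : Site 2 → ℝ} {S T : Set (Site 2)}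
    (H : IsKilledSubharmonicOn Gr h S) (hTS : T ⊆ S) : IsKilledSubharmonicOn Gr h T :=
  fun v hv => H v (hTS hv)

/-- `h` is superharmonic iff `-h` is subharmonic. [folklore] -/
theorem IsKilledSuperharmonicOn.neg {h : Site 2 → ℝ} {S : Set (Site 2)}
    (H : IsKilledSuperharmonicOn Gr h S) : IsKilledSubharmonicOn Gr (-h) S := fun v hv => by
  rw [killedAvg_neg, Pi.neg_apply, neg_le_neg_iff]
  exact H v hv

/-- A subharmonic minus a superharmonic function is subharmonic. [folklore] -/
theorem IsKilledSubharmonicOn.sub {h₁ h₂ : Site 2 → ℝ} {S : Set (Site 2)}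
    (H₁ : IsKilledSubharmonicOn Gr h₁ S) (H₂ : IsKilledSuperharmonicOn Gr h₂ S) :
    IsKilledSubharmonicOn Gr (h₁ - h₂) S := fun v hv => by
  rw [killedAvg_sub, Pi.sub_apply]
  linarith [H₁ v hv, H₂ v hv]

/-- The difference of two harmonic functions is harmonic. [folklore] -/
theorem IsKilledHarmonicOn.sub {h₁ h₂ : Site 2 → ℝ} {S : Set (Site 2)}
    (H₁ : IsKilledHarmonicOn Gr h₁ S) (H₂ : IsKilledHarmonicOn Gr h₂ S) :
    IsKilledHarmonicOn Gr (h₁ - h₂) S := fun v hv => by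
  rw [killedAvg_sub, Pi.sub_apply, ← H₁ v hv, ← H₂ v hv]

/-- The sum of two harmonic functions is harmonic. [folklore] -/
theorem IsKilledHarmonicOn.add {h₁ h₂ : Site 2 → ℝ} {S : Set (Site 2)}
    (H₁ : IsKilledHarmonicOn Gr h₁ S) (H₂ : IsKilledHarmonicOn Gr h₂ S) :
    IsKilledHarmonicOn Gr (h₁ + h₂) S := fun v hv => by
  rw [killedAvg_add, Pi.add_apply, ← H₁ v hv, ← H₂ v hv]

/-- Scalar multiples of harmonic functions are harmonic. [folklore] -/
theorem IsKilledHarmonicOn.const_mul {h : Site 2 → ℝ} {S : Set (Site 2)}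
    (H : IsKilledHarmonicOn Gr h S) (c : ℝ) : IsKilledHarmonicOn Gr (fun x => c * h x) S :=
  fun v hv => by rw [killedAvg_const_mul, ← H v hv]

/-- The zero function is harmonic. [folklore] -/
theorem isKilledHarmonicOn_zero (S : Set (Site 2)) : IsKilledHarmonicOn Gr (fun _ => (0 : ℝ)) S :=
  fun v _ => by simp

/-- Where all four lattice edges are `Gr`-edges at every site of `S`, killed harmonicity is
plain lattice harmonicity. [folklore] -/
theorem isKilledHarmonicOn_iff_isLatticeHarmonicOn {h : Site 2 → ℝ} {S : Set (Site 2)}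
    (hS : ∀ v ∈ S, ∀ e : SRW.Dir 2, Gr.Adj v (v + SRW.stepVec e)) :
    IsKilledHarmonicOn Gr h S ↔ IsLatticeHarmonicOn h S := by
  refine forall₂_congr fun v hv => ?_
  rw [killedAvg_eq_of_forall_adj Gr (hS v hv), latticeLaplacian_eq]
  constructor <;> intro H <;> linarith

/-- Where all four lattice edges are `Gr`-edges at every site of `S`, a killed-subharmonic
function is lattice-subharmonic. [folklore] -/
theorem IsKilledSubharmonicOn.isLatticeSubharmonicOn {h : Site 2 → ℝ} {S : Set (Site 2)}
    (H : IsKilledSubharmonicOn Gr h S) (hS : ∀ v ∈ S, ∀ e : SRW.Dir 2, Gr.Adj v (v + SRW.stepVec e)) :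
    IsLatticeSubharmonicOn h S := fun v hv => by
  have := H v hv
  rw [killedAvg_eq_of_forall_adj Gr (hS v hv)] at this
  rw [latticeLaplacian_eq]
  linarith

/-- **The zero extension of a nonnegative killed-subharmonic function is lattice-subharmonic.**
If `h ≥ 0` everywhere and `h v ≤ killedAvg Gr h v` on `S`, then `Δ h ≥ 0` on `S` for the
nearest-neighbour Laplacian of `ℤ²`: the killed average drops nonnegative terms. (This is how
upper bounds for the site-killed walk transfer to the edge-killed walk.) [folklore] -/
theorem IsKilledSubharmonicOn.isLatticeSubharmonicOn_of_nonneg {h : Site 2 → ℝ} {S : Set (Site 2)}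
    (H : IsKilledSubharmonicOn Gr h S) (hnn : ∀ x, 0 ≤ h x) : IsLatticeSubharmonicOn h S := by
  intro v hv
  have key : killedAvg Gr h v ≤ 4⁻¹ * ∑ k : Fin 4, h (v + cornerUnit k) := by
    rw [killedAvg, ← sum_dir_eq_sum_cornerUnit (fun w => h (v + w))]
    refine mul_le_mul_of_nonneg_left (Finset.sum_le_sum fun e _ => ?_) (by norm_num)
    split_ifs
    · exact le_rfl
    · exact hnn _
  rw [latticeLaplacian_eq]
  linarith [H v hv]

/-! ### The outer boundary for the killed walk and the maximum principle -/

variable (Gr)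

/-- The **outer boundary of `S` for the killed walk**: the sites outside `S` joined to a site of
`S` by a `Gr`-edge in one of the four lattice directions — the sites where the walk started in
`S` can sit at its exit time. [folklore] -/
def killedOuterBoundary (S : Set (Site 2)) : Set (Site 2) :=
  {w | w ∉ S ∧ ∃ v ∈ S, ∃ e : SRW.Dir 2, w = v + SRW.stepVec e ∧ Gr.Adj v w}

variable {Gr}

/-- Membership in the outer boundary, unfolded. [folklore] -/
theorem mem_killedOuterBoundary_iff {S : Set (Site 2)} {w : Site 2} :
    w ∈ killedOuterBoundary Gr S ↔ w ∉ S ∧ ∃ v ∈ S, ∃ e : SRW.Dir 2, w = v + SRW.stepVec e ∧ Gr.Adj v w :=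
  Iff.rfl

/-- A `Gr`-neighbour `v + e` of a site of `S` lies in `S` or in the outer boundary. [folklore] -/
theorem add_stepVec_mem_or_mem_killedOuterBoundary {S : Set (Site 2)} {v : Site 2} (hv : v ∈ S)
    {e : SRW.Dir 2} (hadj : Gr.Adj v (v + SRW.stepVec e)) :
    v + SRW.stepVec e ∈ S ∨ v + SRW.stepVec e ∈ killedOuterBoundary Gr S := by
  by_cases h : v + SRW.stepVec e ∈ S
  · exact Or.inl h
  · exact Or.inr ⟨h, v, hv, e, rfl, hadj⟩

/-- The outer boundary for the killed walk lies in the lattice outer boundary. [folklore] -/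
theorem killedOuterBoundary_subset_latticeOuterBoundary (S : Set (Site 2)) :
    killedOuterBoundary Gr S ⊆ latticeOuterBoundary S := by
  rintro w ⟨hw, v, hv, e, rfl, -⟩
  refine ⟨hw, v, hv, ?_⟩
  have hsum := sum_dir_eq_sum_cornerUnit (fun x => if x = SRW.stepVec e then (1 : ℝ) else 0)
  by_contra hne
  push Not at hne
  have h0 : ∑ k : Fin 4, (if cornerUnit k = SRW.stepVec e then (1 : ℝ) else 0) = 0 :=
    Finset.sum_eq_zero fun k _ => if_neg fun hk => hne k (by rw [hk])
  rw [h0, Finset.sum_eq_single e (fun b _ hb => if_neg fun h => hb (SRW.stepVec_injective h))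
    (fun h => (h (Finset.mem_univ e)).elim)] at hsum
  simp at hsum

/-- The outer boundary of a finite set is finite. [folklore] -/
theorem killedOuterBoundary_finite {S : Set (Site 2)} (hS : S.Finite) :
    (killedOuterBoundary Gr S).Finite :=
  (latticeOuterBoundary_finite hS).subset (killedOuterBoundary_subset_latticeOuterBoundary S)

/-- Walking east by unit steps: `v + (n+1) e₀ = (v + n e₀) + e₀` with `e₀ = stepVec (0, true)`. [folklore] -/
theorem add_succ_nsmul_stepVec (v : Site 2) (n : ℕ) (e : SRW.Dir 2) :
    v + (n + 1) • SRW.stepVec e = v + n • SRW.stepVec e + SRW.stepVec e := by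
  rw [succ_nsmul, add_assoc]

/-- The eastward ray `n ↦ v + n e₀` is injective. [folklore] -/
theorem add_nsmul_stepVec_injective (v : Site 2) :
    Function.Injective fun n : ℕ => v + n • SRW.stepVec ((0, true) : SRW.Dir 2) := by
  intro a b hab
  have h' := congrArg (fun x : Site 2 => x 0) hab
  simp [SRW.stepVec] at h'
  exact_mod_cast h'

/-- **The maximum principle for the killed walk.** Let `S ⊆ ℤ²` be finite, `h` killed-subharmonic
on `S`, and `h ≤ M` on the outer boundary of `S` for the killed walk, where `0 ≤ M` (the walk may
be killed inside `S`, where the cemetery value `0` enters the average). Then `h ≤ M` on `S`.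
(Lawler–Limic 2010, §6.1.) [cite: LawlerLimic2010, §6.1] -/
theorem IsKilledSubharmonicOn.le_of_forall_boundary_le {h : Site 2 → ℝ} {S : Set (Site 2)}
    (hS : S.Finite) (H : IsKilledSubharmonicOn Gr h S) {M : ℝ} (hM0 : 0 ≤ M)
    (hM : ∀ w ∈ killedOuterBoundary Gr S, h w ≤ M) : ∀ v ∈ S, h v ≤ M := by
  intro v₁ hv₁
  by_contra hlt
  push Not at hlt
  obtain ⟨v₀, hv₀S, hmax⟩ := Set.exists_max_image S h hS ⟨v₁, hv₁⟩
  set M' := h v₀ with hM'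
  have hMM' : M < M' := lt_of_lt_of_le hlt (hmax v₁ hv₁)
  -- at a maximiser in `S`, every lattice neighbour is a `Gr`-neighbour in `S` with the same value
  have step : ∀ v ∈ S, h v = M' → ∀ e : SRW.Dir 2,
      Gr.Adj v (v + SRW.stepVec e) ∧ v + SRW.stepVec e ∈ S ∧ h (v + SRW.stepVec e) = M' := by
    intro v hv hvM e
    set t : SRW.Dir 2 → ℝ := fun e =>
      if Gr.Adj v (v + SRW.stepVec e) then h (v + SRW.stepVec e) else 0 with ht
    have hle : ∀ e ∈ (univ : Finset (SRW.Dir 2)), t e ≤ M' := fun e _ => by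
      simp only [ht]
      split_ifs with he
      · rcases add_stepVec_mem_or_mem_killedOuterBoundary hv he with h1 | h1
        · exact hmax _ h1
        · exact (hM _ h1).trans hMM'.le
      · exact hM0.trans hMM'.le
    have hsub : M' ≤ 4⁻¹ * ∑ e, t e := by rw [← hvM]; exact H v hv
    have hsum : ∑ e, t e ≤ ∑ _e : SRW.Dir 2, M' := Finset.sum_le_sum hle
    have hcard : ∑ _e : SRW.Dir 2, M' = 4 * M' := by
      simp only [Finset.sum_const, Finset.card_univ, SRW.card_dir, nsmul_eq_mul]; push_cast; ring
    have heq : ∑ e, t e = ∑ _e : SRW.Dir 2, M' := le_antisymm hsum (by rw [hcard]; linarith)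
    have hte : t e = M' := (Finset.sum_eq_sum_iff_of_le hle).1 heq e (Finset.mem_univ e)
    simp only [ht] at hte
    split_ifs at hte with he
    · refine ⟨he, ?_, hte⟩
      rcases add_stepVec_mem_or_mem_killedOuterBoundary hv he with h1 | h1
      · exact h1
      · exact absurd (hM _ h1) (by rw [hte]; exact not_le.2 hMM')
    · exact absurd hte (by linarith)
  -- propagate eastwards forever inside the finite set `S`
  set e₀ : SRW.Dir 2 := (0, true) with he₀
  have key : ∀ n : ℕ, v₀ + n • SRW.stepVec e₀ ∈ S ∧ h (v₀ + n • SRW.stepVec e₀) = M' := by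
    intro n
    induction n with
    | zero => simp [hM', hv₀S]
    | succ n ih =>
      rw [add_succ_nsmul_stepVec]
      obtain ⟨-, h2, h3⟩ := step _ ih.1 ih.2 e₀
      exact ⟨h2, h3⟩
  exact hS.not_infinite (Set.infinite_of_injective_forall_mem (add_nsmul_stepVec_injective v₀)
    fun n => (key n).1)

/-- **The minimum principle**: a killed-superharmonic function on a finite set which is `≥ m` on
the outer boundary, with `m ≤ 0`, is `≥ m` inside. [folklore] -/
theorem IsKilledSuperharmonicOn.ge_of_forall_boundary_ge {h : Site 2 → ℝ} {S : Set (Site 2)}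
    (hS : S.Finite) (H : IsKilledSuperharmonicOn Gr h S) {m : ℝ} (hm0 : m ≤ 0)
    (hm : ∀ w ∈ killedOuterBoundary Gr S, m ≤ h w) : ∀ v ∈ S, m ≤ h v := by
  intro v hv
  have := H.neg.le_of_forall_boundary_le hS (M := -m) (by linarith)
    (fun w hw => by simpa using hm w hw) v hv
  simpa using this

/-- **Comparison principle**: on a finite set, if `h₁` is killed-subharmonic, `h₂` is
killed-superharmonic and `h₁ ≤ h₂` on the outer boundary, then `h₁ ≤ h₂` inside (no sign
condition: apply the maximum principle to `h₁ - h₂` with `M = 0`). [folklore] -/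
theorem le_of_killedSub_killedSuper_of_boundary {h₁ h₂ : Site 2 → ℝ} {S : Set (Site 2)}
    (hS : S.Finite) (H₁ : IsKilledSubharmonicOn Gr h₁ S) (H₂ : IsKilledSuperharmonicOn Gr h₂ S)
    (hb : ∀ w ∈ killedOuterBoundary Gr S, h₁ w ≤ h₂ w) : ∀ v ∈ S, h₁ v ≤ h₂ v := by
  intro v hv
  have key := (H₁.sub H₂).le_of_forall_boundary_le hS (M := 0) le_rfl
    (fun w hw => by rw [Pi.sub_apply, sub_nonpos]; exact hb w hw) v hv
  rwa [Pi.sub_apply, sub_nonpos] at key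

/-- A nonnegative bound transfers inside: `h` killed-subharmonic on finite `S`, `h ≤ g` on the
outer boundary with `g` killed-superharmonic — special case `g` constant `M ≥ 0` is the maximum
principle; here the form with `h` harmonic. [folklore] -/
theorem IsKilledHarmonicOn.le_of_forall_boundary_le {h : Site 2 → ℝ} {S : Set (Site 2)}
    (hS : S.Finite) (H : IsKilledHarmonicOn Gr h S) {M : ℝ} (hM0 : 0 ≤ M)
    (hM : ∀ w ∈ killedOuterBoundary Gr S, h w ≤ M) : ∀ v ∈ S, h v ≤ M :=
  H.subharmonicOn.le_of_forall_boundary_le hS hM0 hM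

/-- A killed-harmonic function on a finite set which is `≥ m` on the outer boundary, `m ≤ 0`, is
`≥ m` inside; in particular nonnegative boundary values give a nonnegative function. [folklore] -/
theorem IsKilledHarmonicOn.ge_of_forall_boundary_ge {h : Site 2 → ℝ} {S : Set (Site 2)}
    (hS : S.Finite) (H : IsKilledHarmonicOn Gr h S) {m : ℝ} (hm0 : m ≤ 0)
    (hm : ∀ w ∈ killedOuterBoundary Gr S, m ≤ h w) : ∀ v ∈ S, m ≤ h v :=
  H.superharmonicOn.ge_of_forall_boundary_ge hS hm0 hm

/-- **Uniqueness for the Dirichlet problem of the killed walk**: two functions killed-harmonic on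
a finite set which agree on its outer boundary agree on the set. [folklore] -/
theorem IsKilledHarmonicOn.eq_of_eq_boundary {u₁ u₂ : Site 2 → ℝ} {S : Set (Site 2)}
    (hS : S.Finite) (H₁ : IsKilledHarmonicOn Gr u₁ S) (H₂ : IsKilledHarmonicOn Gr u₂ S)
    (hb : ∀ w ∈ killedOuterBoundary Gr S, u₁ w = u₂ w) : ∀ v ∈ S, u₁ v = u₂ v := fun v hv =>
  le_antisymm
    (le_of_killedSub_killedSuper_of_boundary hS H₁.subharmonicOn H₂.superharmonicOn
      (fun w hw => (hb w hw).le) v hv)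
    (le_of_killedSub_killedSuper_of_boundary hS H₂.subharmonicOn H₁.superharmonicOn
      (fun w hw => (hb w hw).ge) v hv)

/-! ### Existence for the Dirichlet problem on a finite set -/

variable (Gr)

/-- **The Dirichlet operator of the killed walk** on the set `S`:
`u ↦ (killedAvg (extendByZero u) - extendByZero u)|_S`, a linear endomorphism of `S → ℝ`. [folklore] -/
def killedDirichletOperator (S : Set (Site 2)) : (S → ℝ) →ₗ[ℝ] (S → ℝ) where
  toFun u := fun v => killedAvg Gr (extendByZero S u) v - extendByZero S u v
  map_add' u₁ u₂ := by
    funext v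
    rw [extendByZero_add, killedAvg_add]
    simp only [Pi.add_apply]
    ring
  map_smul' c u := by
    funext v
    rw [extendByZero_smul, killedAvg_const_mul]
    simp only [Pi.smul_apply, smul_eq_mul, RingHom.id_apply]
    ring

variable {Gr}

/-- The Dirichlet operator of a finite set is injective: a killed-harmonic function on `S`
vanishing off `S` vanishes. [folklore] -/
theorem killedDirichletOperator_injective {S : Set (Site 2)} (hS : S.Finite) :
    Function.Injective (killedDirichletOperator Gr S) := by
  refine (injective_iff_map_eq_zero _).2 fun u hu => ?_
  have hharm : IsKilledHarmonicOn Gr (extendByZero S u) S := fun v hv => by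
    have := congrArg (fun f : S → ℝ => f ⟨v, hv⟩) hu
    simp only [killedDirichletOperator, LinearMap.coe_mk, AddHom.coe_mk, Pi.zero_apply] at this
    linarith
  funext ⟨v, hv⟩
  have key := hharm.eq_of_eq_boundary hS (isKilledHarmonicOn_zero S)
    (fun w hw => by rw [extendByZero_of_not_mem u hw.1]) v hv
  rw [extendByZero_of_mem u hv] at key
  exact key

/-- **Existence for the Dirichlet problem of the killed walk on a finite set.** For finite
`S ⊆ ℤ²` and any `g : ℤ² → ℝ` there is a function equal to `g` off `S` and killed-harmonic on `S`
(finite-dimensional linear algebra). (Lawler–Limic 2010, §6.1.) [cite: LawlerLimic2010, §6.1] -/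
theorem exists_isKilledHarmonicOn_eq_off {S : Set (Site 2)} (hS : S.Finite) (g : Site 2 → ℝ) :
    ∃ u : Site 2 → ℝ, IsKilledHarmonicOn Gr u S ∧ ∀ w ∉ S, u w = g w := by
  haveI : Fintype S := hS.fintype
  let g₀ : Site 2 → ℝ := fun x => if x ∈ S then 0 else g x
  have hsurj : Function.Surjective (killedDirichletOperator Gr S) :=
    LinearMap.injective_iff_surjective.1 (killedDirichletOperator_injective hS)
  obtain ⟨u, hu⟩ := hsurj fun v => -(killedAvg Gr g₀ v - g₀ v)
  refine ⟨extendByZero S u + g₀, fun v hv => ?_, fun w hw => ?_⟩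
  · have h1 := congrArg (fun f : S → ℝ => f ⟨v, hv⟩) hu
    simp only [killedDirichletOperator, LinearMap.coe_mk, AddHom.coe_mk] at h1
    rw [killedAvg_add, Pi.add_apply]
    linarith
  · simp [g₀, extendByZero_of_not_mem u hw, hw]

variable (Gr)

/-- **The solution operator of the Dirichlet problem**: for finite `S`, `killedHarmExt Gr S g` is
killed-harmonic on `S` and equals `g` off `S`; for infinite `S` the junk value `g`. [folklore] -/
def killedHarmExt (S : Set (Site 2)) (g : Site 2 → ℝ) : Site 2 → ℝ :=
  if hS : S.Finite then (exists_isKilledHarmonicOn_eq_off (Gr := Gr) hS g).choose else g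

variable {Gr}

/-- The solution is killed-harmonic on `S`. [folklore] -/
theorem killedHarmExt_harmonicOn {S : Set (Site 2)} (hS : S.Finite) (g : Site 2 → ℝ) :
    IsKilledHarmonicOn Gr (killedHarmExt Gr S g) S := by
  unfold killedHarmExt; rw [dif_pos hS]
  exact (exists_isKilledHarmonicOn_eq_off (Gr := Gr) hS g).choose_spec.1

/-- Off `S` the solution is the data. [folklore] -/
theorem killedHarmExt_of_not_mem {S : Set (Site 2)} (g : Site 2 → ℝ) {w : Site 2} (hw : w ∉ S) :
    killedHarmExt Gr S g w = g w := by
  unfold killedHarmExt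
  split_ifs with hS
  · exact (exists_isKilledHarmonicOn_eq_off (Gr := Gr) hS g).choose_spec.2 w hw
  · rfl

/-- **Characterisation**: a function killed-harmonic on finite `S` agreeing with `g` on the outer
boundary is the solution on `S`. [folklore] -/
theorem IsKilledHarmonicOn.eq_killedHarmExt {S : Set (Site 2)} (hS : S.Finite) {u g : Site 2 → ℝ}
    (hu : IsKilledHarmonicOn Gr u S) (hb : ∀ w ∈ killedOuterBoundary Gr S, u w = g w) :
    ∀ v ∈ S, u v = killedHarmExt Gr S g v :=
  hu.eq_of_eq_boundary hS (killedHarmExt_harmonicOn hS g) fun w hw => by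
    rw [hb w hw, killedHarmExt_of_not_mem g hw.1]

/-- Only the values of the data on the outer boundary matter. [folklore] -/
theorem killedHarmExt_congr {S : Set (Site 2)} (hS : S.Finite) {g₁ g₂ : Site 2 → ℝ}
    (hb : ∀ w ∈ killedOuterBoundary Gr S, g₁ w = g₂ w) :
    ∀ v ∈ S, killedHarmExt Gr S g₁ v = killedHarmExt Gr S g₂ v :=
  (killedHarmExt_harmonicOn hS g₁).eq_killedHarmExt hS fun w hw => by
    rw [killedHarmExt_of_not_mem g₁ hw.1, hb w hw]

/-- **Upper bound**: data `≤ M` on the outer boundary with `0 ≤ M` gives a solution `≤ M` on `S`. [folklore] -/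
theorem killedHarmExt_le {S : Set (Site 2)} (hS : S.Finite) {g : Site 2 → ℝ} {M : ℝ} (hM0 : 0 ≤ M)
    (hg : ∀ w ∈ killedOuterBoundary Gr S, g w ≤ M) : ∀ v ∈ S, killedHarmExt Gr S g v ≤ M :=
  (killedHarmExt_harmonicOn hS g).le_of_forall_boundary_le hS hM0 fun w hw => by
    rw [killedHarmExt_of_not_mem g hw.1]; exact hg w hw

/-- **Lower bound**: data `≥ m` on the outer boundary with `m ≤ 0` gives a solution `≥ m` on `S`. [folklore] -/
theorem le_killedHarmExt {S : Set (Site 2)} (hS : S.Finite) {g : Site 2 → ℝ} {m : ℝ} (hm0 : m ≤ 0)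
    (hg : ∀ w ∈ killedOuterBoundary Gr S, m ≤ g w) : ∀ v ∈ S, m ≤ killedHarmExt Gr S g v :=
  (killedHarmExt_harmonicOn hS g).ge_of_forall_boundary_ge hS hm0 fun w hw => by
    rw [killedHarmExt_of_not_mem g hw.1]; exact hg w hw

/-- Nonnegative data give a nonnegative solution everywhere. [folklore] -/
theorem killedHarmExt_nonneg {S : Set (Site 2)} (hS : S.Finite) {g : Site 2 → ℝ} (hg : ∀ w, 0 ≤ g w)
    (v : Site 2) : 0 ≤ killedHarmExt Gr S g v := by
  by_cases hv : v ∈ S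
  · exact le_killedHarmExt hS le_rfl (fun w _ => hg w) v hv
  · rw [killedHarmExt_of_not_mem g hv]; exact hg v

/-- Data in `[0, M]` give a solution in `[0, M]` everywhere. [folklore] -/
theorem killedHarmExt_le' {S : Set (Site 2)} (hS : S.Finite) {g : Site 2 → ℝ} {M : ℝ} (hM0 : 0 ≤ M)
    (hg : ∀ w, g w ≤ M) (v : Site 2) : killedHarmExt Gr S g v ≤ M := by
  by_cases hv : v ∈ S
  · exact killedHarmExt_le hS hM0 (fun w _ => hg w) v hv
  · rw [killedHarmExt_of_not_mem g hv]; exact hg v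

/-- The solution operator is additive in the data (on `S`; off `S` trivially). [folklore] -/
theorem killedHarmExt_add {S : Set (Site 2)} (hS : S.Finite) (g₁ g₂ : Site 2 → ℝ) (v : Site 2) :
    killedHarmExt Gr S (g₁ + g₂) v = killedHarmExt Gr S g₁ v + killedHarmExt Gr S g₂ v := by
  by_cases hv : v ∈ S
  · symm
    have := ((killedHarmExt_harmonicOn (Gr := Gr) hS g₁).add (killedHarmExt_harmonicOn hS g₂)).eq_killedHarmExt
      hS (g := g₁ + g₂) (fun w hw => by
        simp only [Pi.add_apply, killedHarmExt_of_not_mem _ hw.1]) v hv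
    simpa using this
  · simp [killedHarmExt_of_not_mem _ hv]

/-- The solution operator is homogeneous in the data. [folklore] -/
theorem killedHarmExt_const_mul {S : Set (Site 2)} (hS : S.Finite) (c : ℝ) (g : Site 2 → ℝ) (v : Site 2) :
    killedHarmExt Gr S (fun x => c * g x) v = c * killedHarmExt Gr S g v := by
  by_cases hv : v ∈ S
  · symm
    exact ((killedHarmExt_harmonicOn (Gr := Gr) hS g).const_mul c).eq_killedHarmExt hS
      (g := fun x => c * g x) (fun w hw => by rw [killedHarmExt_of_not_mem _ hw.1]) v hv
  · simp [killedHarmExt_of_not_mem _ hv]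

/-- The solution operator is monotone in the boundary data. [folklore] -/
theorem killedHarmExt_mono {S : Set (Site 2)} (hS : S.Finite) {g₁ g₂ : Site 2 → ℝ}
    (hg : ∀ w ∈ killedOuterBoundary Gr S, g₁ w ≤ g₂ w) :
    ∀ v ∈ S, killedHarmExt Gr S g₁ v ≤ killedHarmExt Gr S g₂ v :=
  le_of_killedSub_killedSuper_of_boundary hS (killedHarmExt_harmonicOn hS g₁).subharmonicOn
    (killedHarmExt_harmonicOn hS g₂).superharmonicOn fun w hw => by
      rw [killedHarmExt_of_not_mem _ hw.1, killedHarmExt_of_not_mem _ hw.1]; exact hg w hw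

/-- **Sub-mean value comparison**: a killed-subharmonic `u` on finite `S` with `u ≤ g` on the outer
boundary is dominated on `S` by the harmonic extension of `g`. [folklore] -/
theorem IsKilledSubharmonicOn.le_killedHarmExt {S : Set (Site 2)} (hS : S.Finite) {u g : Site 2 → ℝ}
    (hu : IsKilledSubharmonicOn Gr u S) (hb : ∀ w ∈ killedOuterBoundary Gr S, u w ≤ g w) :
    ∀ v ∈ S, u v ≤ killedHarmExt Gr S g v :=
  le_of_killedSub_killedSuper_of_boundary hS hu (killedHarmExt_harmonicOn hS g).superharmonicOn
    fun w hw => by rw [killedHarmExt_of_not_mem _ hw.1]; exact hb w hw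

/-- **Super-mean value comparison**: a killed-superharmonic `u` on finite `S` with `g ≤ u` on the
outer boundary dominates the harmonic extension of `g` on `S`. [folklore] -/
theorem IsKilledSuperharmonicOn.killedHarmExt_le {S : Set (Site 2)} (hS : S.Finite) {u g : Site 2 → ℝ}
    (hu : IsKilledSuperharmonicOn Gr u S) (hb : ∀ w ∈ killedOuterBoundary Gr S, g w ≤ u w) :
    ∀ v ∈ S, killedHarmExt Gr S g v ≤ u v :=
  le_of_killedSub_killedSuper_of_boundary hS (killedHarmExt_harmonicOn hS g).subharmonicOn hu
    fun w hw => by rw [killedHarmExt_of_not_mem _ hw.1]; exact hb w hw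

/-! ### The Poisson kernel (exit distribution) and the exit representation -/

variable (Gr)

/-- **The Poisson kernel of the killed walk in `S`**: `killedPoisson Gr S v x` is the value at `v`
of the killed-harmonic function on `S` with data the indicator of `{x}` — the probability that the
walk started at `v`, run along `Gr` and killed at its first non-`Gr` step, leaves `S` alive and
does so at `x` (Lawler–Limic 2010, §6.2, `H_A(x,y)`). [cite: LawlerLimic2010, §6.2] -/
def killedPoisson (S : Set (Site 2)) (v x : Site 2) : ℝ :=
  killedHarmExt Gr S (fun w => if w = x then 1 else 0) v

variable {Gr}

/-- The Poisson kernel is killed-harmonic in its first variable. [folklore] -/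
theorem killedPoisson_harmonicOn {S : Set (Site 2)} (hS : S.Finite) (x : Site 2) :
    IsKilledHarmonicOn Gr (fun v => killedPoisson Gr S v x) S :=
  killedHarmExt_harmonicOn hS _

/-- Off `S` the Poisson kernel is the indicator. [folklore] -/
theorem killedPoisson_of_not_mem {S : Set (Site 2)} {v : Site 2} (hv : v ∉ S) (x : Site 2) :
    killedPoisson Gr S v x = if v = x then 1 else 0 :=
  killedHarmExt_of_not_mem _ hv

/-- The Poisson kernel is nonnegative. [folklore] -/
theorem killedPoisson_nonneg {S : Set (Site 2)} (hS : S.Finite) (v x : Site 2) :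
    0 ≤ killedPoisson Gr S v x :=
  killedHarmExt_nonneg hS (fun w => by split_ifs <;> norm_num) v

/-- The Poisson kernel is at most one. [folklore] -/
theorem killedPoisson_le_one {S : Set (Site 2)} (hS : S.Finite) (v x : Site 2) :
    killedPoisson Gr S v x ≤ 1 :=
  killedHarmExt_le' hS zero_le_one (fun w => by split_ifs <;> norm_num) v

/-- The Poisson kernel with pole outside the outer boundary vanishes on `S`. [folklore] -/
theorem killedPoisson_eq_zero_of_not_mem_boundary {S : Set (Site 2)} (hS : S.Finite) {x : Site 2}
    (hx : x ∉ killedOuterBoundary Gr S) : ∀ v ∈ S, killedPoisson Gr S v x = 0 := by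
  intro v hv
  have := killedHarmExt_congr hS (g₁ := fun w => if w = x then (1 : ℝ) else 0) (g₂ := fun _ => 0)
    (fun w hw => by
      have hwx : w ≠ x := fun h => hx (h ▸ hw)
      simp [hwx]) v hv
  rw [killedPoisson, this]
  exact ((isKilledHarmonicOn_zero S).eq_killedHarmExt hS (g := fun _ => (0:ℝ)) (fun _ _ => rfl) v hv).symm

/-- **Exit representation of the solution of the Dirichlet problem**: on a finite set, the
harmonic extension of `g` is `∑_{x ∈ ∂S} killedPoisson Gr S v x · g x`, the sum over the (finite)
outer boundary for the killed walk. [cite: LawlerLimic2010, §6.2] -/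
theorem killedHarmExt_eq_sum_killedPoisson {S : Set (Site 2)} (hS : S.Finite) (g : Site 2 → ℝ) :
    ∀ v ∈ S, killedHarmExt Gr S g v =
      ∑ x ∈ (killedOuterBoundary_finite (Gr := Gr) hS).toFinset, killedPoisson Gr S v x * g x := by
  set B := (killedOuterBoundary_finite (Gr := Gr) hS).toFinset with hB
  -- the finite sum is killed-harmonic with the right boundary values
  have hharm : IsKilledHarmonicOn Gr (fun v => ∑ x ∈ B, killedPoisson Gr S v x * g x) S := by
    induction B using Finset.induction_on with
    | empty => simpa using isKilledHarmonicOn_zero S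
    | insert a s ha ih =>
      simp only [Finset.sum_insert ha]
      refine IsKilledHarmonicOn.add ?_ ih
      have := (killedPoisson_harmonicOn (Gr := Gr) hS a).const_mul (g a)
      have heq : (fun v => killedPoisson Gr S v a * g a) = fun x => g a * killedPoisson Gr S x a := by
        funext w; ring
      rw [heq]
      exact this
  intro v hv
  symm
  refine hharm.eq_killedHarmExt hS (fun w hw => ?_) v hv
  have hwB : w ∈ B := by rw [hB, Set.Finite.mem_toFinset]; exact hw
  rw [Finset.sum_eq_single_of_mem w hwB (fun x _ hxw => by
    rw [killedPoisson_of_not_mem hw.1, if_neg (Ne.symm hxw), zero_mul])]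
  rw [killedPoisson_of_not_mem hw.1, if_pos rfl, one_mul]

/-- **Exit representation of a killed-harmonic function**: if `h` is killed-harmonic on the finite
set `S`, then `h v = ∑_{x ∈ ∂S} killedPoisson Gr S v x · h x` for `v ∈ S`. [cite: LawlerLimic2010, §6.2] -/
theorem IsKilledHarmonicOn.eq_sum_killedPoisson {S : Set (Site 2)} (hS : S.Finite) {h : Site 2 → ℝ}
    (H : IsKilledHarmonicOn Gr h S) :
    ∀ v ∈ S, h v = ∑ x ∈ (killedOuterBoundary_finite (Gr := Gr) hS).toFinset, killedPoisson Gr S v x * h x :=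
  fun v hv => (H.eq_killedHarmExt hS (g := h) (fun _ _ => rfl) v hv).trans
    (killedHarmExt_eq_sum_killedPoisson hS h v hv)

/-- The total exit mass is at most one: `∑_{x ∈ ∂S} killedPoisson Gr S v x ≤ 1`. [folklore] -/
theorem sum_killedPoisson_le_one {S : Set (Site 2)} (hS : S.Finite) :
    ∀ v ∈ S, ∑ x ∈ (killedOuterBoundary_finite (Gr := Gr) hS).toFinset, killedPoisson Gr S v x ≤ 1 := by
  intro v hv
  have h1 := killedHarmExt_eq_sum_killedPoisson (Gr := Gr) hS (fun _ => (1 : ℝ)) v hv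
  simp only [mul_one] at h1
  rw [← h1]
  exact killedHarmExt_le hS zero_le_one (fun _ _ => le_rfl) v hv

/-- **Two-sided averaging bound**: a killed-harmonic `h` on finite `S` with `m ≤ h ≤ M` on the outer
boundary (`m ≤ 0 ≤ M`) satisfies `m ≤ h ≤ M` on `S`. [folklore] -/
theorem IsKilledHarmonicOn.mem_Icc_of_boundary {S : Set (Site 2)} (hS : S.Finite) {h : Site 2 → ℝ}
    (H : IsKilledHarmonicOn Gr h S) {m M : ℝ} (hm0 : m ≤ 0) (hM0 : 0 ≤ M)
    (hb : ∀ w ∈ killedOuterBoundary Gr S, m ≤ h w ∧ h w ≤ M) : ∀ v ∈ S, m ≤ h v ∧ h v ≤ M :=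
  fun v hv => ⟨H.ge_of_forall_boundary_ge hS hm0 (fun w hw => (hb w hw).1) v hv,
    H.le_of_forall_boundary_le hS hM0 (fun w hw => (hb w hw).2) v hv⟩

end Literature.Probability.LatticeModels
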